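import Summits.ABC.IUTFork.Charitable.Thm311D1PerPlaceSeparationSub
import HarnessLib

/-!
# Branch D, team D1 — KIT III: a VECTOR-RESOLVING region operator (equivariant and local), for the per-place rung vs S itself

Record file (D-0012; abc-iut cell, rung LADDER-ABC:A2.D; abc-iut-D1-prv gen 2; item (δ′) of plan/D-ref/GRADE.md §(ii), holder line
«separating model (per-place ∧ pins ∧ ¬S) … OPEN, holders D1-prv g2»). TAKES NO SIDE on [IUTchIII] Cor. 3.12 or on any author; NO `Prop`
fact; MODEL DATA = one region-forming operator `fineRegion` and one auxiliary vector `ghostTheta`; bookkeeping `rebase`; the rest theorems.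
WHY AN OPERATOR. S := `Cor312Vol.PilotKummerIndRelated S P ρ qK` is relative to the region-forming operator `ρ` (PR-1's binder; the
Corollary's pins ask `ρ` to be (hρ)-equivariant under ⟨(Ind1)∪(Ind2)⟩ and to produce the pilot regions). At the operators of record
(sign-blind cylinders) the per-place square implies S (p431983); p435474/p438449 separate the per-place square from the UNIFORM square.
Here: the operator `fineRegion X j v_ℚ` := the vectors of the packet `(j, v_ℚ)` having the tuple coordinates (Kit I `coordTuple`) of the
`j`-component of some element of the datum `X` at some bad place over `v_ℚ` — it READS the data vector by vector. PROVED: it is LOCAL over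
`v_ℚ` (`fineRegion_local`) and (hρ)-EQUIVARIANT under the whole group ⟨(Ind1)∪(Ind2)⟩ (`fineRegion_equivariant`, from Kit II's
separable signs `sepSignedAt_of_mem_closure`: a group element acts on tuple coordinates by one capsule permutation and a sign depending
only on the places read, so it carries coordinate-classes to coordinate-classes; the reverse inclusion by the inverse element).
Also: `sign_ratio'` (Kit II's `sign_ratio` with the vector equation replaced by equality of all tuple coordinates), the rebased theta
coordinates (`coordTuple_rebase_thetaVec1`) and the «ghost» of a theta vector in the packet of another place over the same `v_ℚ`
(`ghostTheta`, `coordTuple_ghostTheta`). Consumer: `Charitable/Thm311D1PerPlaceFineSeparation.lean` (per-place square ∧ ¬S at this operator).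
[claim: Mochizuki2012, status: disputed] (node texts: Thm. 3.11 (i) (Ind1)/(Ind2), S. Mochizuki, *Inter-universal Teichmüller theory III*,
kurims (May 2020) p. 154) Standard axioms; elementary bookkeeping on the typed carrier; typed ≠ proved.
-/

noncomputable section

open Set

namespace Summit.ABC.IUTFork.Charitable

open Thm311 Cor312 Cor312Vol Literature.IUT.LogThetaLattice

variable {T : ThetaIndex}

/-! ## 1. Rebasing tuples of places between two presentations of one rational place -/

/-- Rebase a tuple of places over `v_ℚ` to the (equal) rational place `v_ℚ′` — same underlying places. [folklore] -/
def rebase {j : T.Label} {vQ vQ' : T.VQ} (h : vQ' = vQ) (w : T.Caps j → T.Fibre vQ) : T.Caps j → T.Fibre vQ' :=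
  fun i => ⟨(w i).1, (w i).2.trans h.symm⟩

/-- Rebasing keeps the underlying places. [folklore] -/
@[simp] theorem rebase_val {j : T.Label} {vQ vQ' : T.VQ} (h : vQ' = vQ) (w : T.Caps j → T.Fibre vQ) (i : T.Caps j) :
    (rebase h w i).1 = (w i).1 := rfl

/-- Rebasing along a reflexive equation is the identity. [folklore] -/
@[simp] theorem rebase_self {j : T.Label} {vQ : T.VQ} (h : vQ = vQ) (w : T.Caps j → T.Fibre vQ) : rebase h w = w :=
  funext fun _ => Subtype.ext rfl

/-- Rebasing there and back is the identity. [folklore] -/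
@[simp] theorem rebase_rebase {j : T.Label} {vQ vQ' : T.VQ} (h : vQ' = vQ) (h' : vQ = vQ') (w : T.Caps j → T.Fibre vQ) :
    rebase h' (rebase h w) = w :=
  funext fun _ => Subtype.ext rfl

/-- Rebasing commutes with re-indexing by a capsule permutation. [folklore] -/
theorem rebase_perm {j : T.Label} {vQ vQ' : T.VQ} (h : vQ' = vQ) (w : T.Caps j → T.Fibre vQ) (τ : Equiv.Perm (T.Caps j)) :
    (fun i => rebase h w (τ i)) = rebase h (fun i => w (τ i)) := rfl

/-! ## 2. The vector-resolving operator -/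

/-- **`fineRegion` — a VECTOR-RESOLVING region-forming operator**: in the packet `(j, v_ℚ)`, `j ≠ 0`, the vectors having the tuple
coordinates of the `j`-component of some element of the datum at some bad place over `v_ℚ` (the data themselves, rebased to the packet's
presentation of `v_ℚ`); everything at the zero label. MODEL DATA for PR-1's binder `ρ`. [folklore] -/
def fineRegion (X : ∀ v : T.V, v ∈ T.Vbad → Set ((NaiveProv.signShells T).StarPacket v)) (j : T.Label) (vQ : T.VQ) :
    Set ((NaiveProv.signShells T).Packet j vQ) :=
  if hj : j ≠ 0 then
    {t | ∃ (v : T.V) (hv : v ∈ T.Vbad) (hvQ : T.over v = vQ), ∃ ψ ∈ X v hv,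
      ∀ w : T.Caps j → T.Fibre vQ, coordTuple j vQ w t = coordTuple j (T.over v) (rebase hvQ w) (ψ ⟨j, hj⟩)}
  else Set.univ

/-- Unfolding at a nonzero label. [folklore] -/
theorem mem_fineRegion_iff {X : ∀ v : T.V, v ∈ T.Vbad → Set ((NaiveProv.signShells T).StarPacket v)} {j : T.Label} (hj : j ≠ 0)
    {vQ : T.VQ} {t : (NaiveProv.signShells T).Packet j vQ} :
    t ∈ fineRegion X j vQ ↔ ∃ (v : T.V) (hv : v ∈ T.Vbad) (hvQ : T.over v = vQ), ∃ ψ ∈ X v hv,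
      ∀ w : T.Caps j → T.Fibre vQ, coordTuple j vQ w t = coordTuple j (T.over v) (rebase hvQ w) (ψ ⟨j, hj⟩) := by
  unfold fineRegion; rw [dif_pos hj]; rfl

/-- At the zero label the operator returns everything. [folklore] -/
theorem fineRegion_zero_label (X : ∀ v : T.V, v ∈ T.Vbad → Set ((NaiveProv.signShells T).StarPacket v)) (vQ : T.VQ) :
    fineRegion X 0 vQ = Set.univ := by
  unfold fineRegion; rw [dif_neg (fun h => h rfl)]

/-- **`fineRegion` is LOCAL over `v_ℚ`** (p431983's `LocalOverVQ`), at the index-generic model of record. [folklore] -/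
theorem fineRegion_local (p : ℕ) (vQ₀ : T.VQ) (c : ℝ) :
    LocalOverVQ (NaiveProv.full1 p vQ₀ c).toLatticeSituation fineRegion := by
  intro X Y j vQ h
  by_cases hj : j ≠ 0
  · ext t
    rw [mem_fineRegion_iff hj, mem_fineRegion_iff hj]
    constructor
    · rintro ⟨v, hv, hvQ, ψ, hψ, ht⟩
      exact ⟨v, hv, hvQ, ψ, (h v hv hvQ) ▸ hψ, ht⟩
    · rintro ⟨v, hv, hvQ, ψ, hψ, ht⟩
      exact ⟨v, hv, hvQ, ψ, (h v hv hvQ).symm ▸ hψ, ht⟩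
  · have hj0 : j = 0 := not_not.mp hj
    subst hj0
    rw [fineRegion_zero_label, fineRegion_zero_label]

/-- The star action of the inverse undoes the star action (pointwise). [folklore] -/
theorem starAut_inv_apply (Φ : (NaiveProv.signShells T).PacketAut) (v : T.V) (x : (NaiveProv.signShells T).StarPacket v) :
    (NaiveProv.signShells T).starAut Φ⁻¹ v ((NaiveProv.signShells T).starAut Φ v x) = x := by
  funext j
  simp [LogShells.starAut]

/-- Transporting a datum by `Φ` and then by `Φ⁻¹` gives the datum back. [folklore] -/
theorem starAut_inv_image_image (Φ : (NaiveProv.signShells T).PacketAut) (v : T.V)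
    (A : Set ((NaiveProv.signShells T).StarPacket v)) :
    (NaiveProv.signShells T).starAut Φ⁻¹ v '' ((NaiveProv.signShells T).starAut Φ v '' A) = A := by
  rw [Set.image_image]
  convert Set.image_id A using 2
  exact starAut_inv_apply Φ v _

/-- One inclusion of equivariance: transporting a coordinate-class by `Φ` lands in the coordinate-class of the transported datum
(Kit II: `Φ` acts on tuple coordinates by one capsule permutation and a place-separable sign). [folklore] -/
theorem image_fineRegion_subset {Φ : (NaiveProv.signShells T).PacketAut}
    (hΦ : Φ ∈ Subgroup.closure ((NaiveProv.signShells T).Ind1Family ∪ (NaiveProv.signShells T).Ind2Family))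
    (X : ∀ v : T.V, v ∈ T.Vbad → Set ((NaiveProv.signShells T).StarPacket v)) (j : T.Label) (vQ : T.VQ) :
    Φ j vQ '' fineRegion X j vQ ⊆ fineRegion (fun v hv => (NaiveProv.signShells T).starAut Φ v '' X v hv) j vQ := by
  by_cases hj : j ≠ 0
  · rintro _ ⟨s, hs, rfl⟩
    rw [mem_fineRegion_iff hj] at hs ⊢
    obtain ⟨v, hv, hvQ, ψ, hψ, hcoord⟩ := hs
    subst hvQ
    obtain ⟨τ, e, -, hτe⟩ := sepSignedAt_of_mem_closure hΦ j (T.over v)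
    refine ⟨v, hv, rfl, (NaiveProv.signShells T).starAut Φ v ψ, ⟨ψ, hψ, rfl⟩, fun w => ?_⟩
    have happ : ((NaiveProv.signShells T).starAut Φ v ψ) ⟨j, hj⟩ = Φ j (T.over v) (ψ ⟨j, hj⟩) := by
      simp [LogShells.starAut]
    rw [happ, rebase_self, hτe w s, hτe w (ψ ⟨j, hj⟩), hcoord (fun i => w (τ i)), rebase_self]
  · have hj0 : j = 0 := not_not.mp hj
    subst hj0
    rw [fineRegion_zero_label, fineRegion_zero_label]
    exact Set.subset_univ _

/-- **`fineRegion` is (hρ)-EQUIVARIANT under the whole group ⟨(Ind1)∪(Ind2)⟩** (the first conjunct of the Θ-pin `ThetaPinned`): transporting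
the datum by `Φ` transports the region by `Φ`. [folklore] -/
theorem fineRegion_equivariant {Φ : (NaiveProv.signShells T).PacketAut}
    (hΦ : Φ ∈ Subgroup.closure ((NaiveProv.signShells T).Ind1Family ∪ (NaiveProv.signShells T).Ind2Family))
    (X : ∀ v : T.V, v ∈ T.Vbad → Set ((NaiveProv.signShells T).StarPacket v)) (j : T.Label) (vQ : T.VQ) :
    fineRegion (fun v hv => (NaiveProv.signShells T).starAut Φ v '' X v hv) j vQ = Φ j vQ '' fineRegion X j vQ := by
  refine Set.Subset.antisymm (fun t ht => ?_) (image_fineRegion_subset hΦ X j vQ)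
  have hΦ' : Φ⁻¹ ∈ Subgroup.closure ((NaiveProv.signShells T).Ind1Family ∪ (NaiveProv.signShells T).Ind2Family) := inv_mem hΦ
  have h1 := image_fineRegion_subset hΦ' (fun v hv => (NaiveProv.signShells T).starAut Φ v '' X v hv) j vQ ⟨t, ht, rfl⟩
  have hX : (fun v hv => (NaiveProv.signShells T).starAut Φ⁻¹ v '' ((NaiveProv.signShells T).starAut Φ v '' X v hv)) = X :=
    funext fun v => funext fun hv => starAut_inv_image_image Φ v (X v hv)
  rw [hX] at h1
  refine ⟨Φ⁻¹ j vQ t, h1, ?_⟩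
  simp only [Pi.inv_apply, LinearEquiv.coe_inv, LinearEquiv.apply_symm_apply]

/-! ## 3. Theta coordinates rebased; the ghost of a theta vector in another place's packet; `sign_ratio` on coordinates -/

section Theta

variable (p : ℕ)

open scoped Classical in
/-- The one-factor theta vector of `u` read along a REBASED tuple: `q^{j²}` iff the `α = j` factor is read at the place `u`. [folklore] -/
theorem coordTuple_rebase_thetaVec1 {u : T.V} {vQ : T.VQ} (hu : T.over u = vQ) (j : T.Label) (w : T.Caps j → T.Fibre vQ) :
    coordTuple j (T.over u) (rebase hu w) (NaiveProv.thetaVec1 p u j) =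
      if (w (T.selfIndex j)).1 = u then (p : ℚ) ^ ((j : ℕ) ^ 2) else 0 := by
  rw [coordTuple_thetaVec1]
  have hiff : rebase hu w (T.selfIndex j) = T.toFibre u ↔ (w (T.selfIndex j)).1 = u :=
    ⟨fun h => congrArg Subtype.val h, fun h => Subtype.ext h⟩
  by_cases h : (w (T.selfIndex j)).1 = u
  · rw [if_pos (hiff.2 h), if_pos h]
  · rw [if_neg (fun h' => h (hiff.1 h')), if_neg h]

open scoped Classical in
/-- **The GHOST of the theta vector of the place `x` in the packet `(j, v_ℚ)`**: the pure tensor whose `α = j` factor is `q^{j²}` on the summand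
`x` and `0` elsewhere, the other factors all-ones — it has the tuple coordinates of `θ_{x,j}` (rebased). MODEL DATA. [folklore] -/
def ghostTheta (x : T.V) (vQ : T.VQ) (j : T.Label) : (NaiveProv.signShells T).Packet j vQ :=
  PiTensorProduct.tprod ℚ fun (i : T.Caps j) (u : T.Fibre vQ) =>
    if i = T.selfIndex j then (if u.1 = x then (p : ℚ) ^ ((j : ℕ) ^ 2) else 0) else 1

open scoped Classical in
/-- Tuple coordinates of the ghost: `q^{j²}` iff the `α = j` factor is read at `x`. [folklore] -/
theorem coordTuple_ghostTheta (x : T.V) (vQ : T.VQ) (j : T.Label) (w : T.Caps j → T.Fibre vQ) :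
    coordTuple j vQ w (ghostTheta p x vQ j) = if (w (T.selfIndex j)).1 = x then (p : ℚ) ^ ((j : ℕ) ^ 2) else 0 := by
  unfold ghostTheta
  rw [coordTuple_tprod, Finset.prod_eq_single (T.selfIndex j)]
  · simp
  · intro i _ hi
    simp [hi]
  · intro h
    exact absurd (Finset.mem_univ _) h

/-- **Sign ratio, coordinate form** (Kit II `sign_ratio` with «`Φ (f j)` has the tuple coordinates of `t₀`» in place of `Φ (f j) = t₀`).
[folklore] -/
theorem sign_ratio' [hp : Fact p.Prime] {Φ : (NaiveProv.signShells T).PacketAut} {u : T.V}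
    (b : T.Fibre (T.over u)) (hb : b ≠ T.toFibre u) (j : T.LabelStar)
    {τ : Equiv.Perm (T.Caps j.1)} {e : T.Caps j.1 → T.V → ℚ}
    (hτe : ∀ (w : T.Caps j.1 → T.Fibre (T.over u)) t, coordTuple j.1 (T.over u) w (Φ j.1 (T.over u) t) =
      (∏ i, e i (w i).1) * coordTuple j.1 (T.over u) (fun i => w (τ i)) t)
    {f : (NaiveProv.signShells T).StarPacket u} (hf : f ∈ NaiveProv.PsiOf (NaiveProv.thetaVec1 p) u)
    {t₀ : (NaiveProv.signShells T).Packet j.1 (T.over u)}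
    (ht : ∀ w : T.Caps j.1 → T.Fibre (T.over u), coordTuple j.1 (T.over u) w (Φ j.1 (T.over u) (f j)) = coordTuple j.1 (T.over u) w t₀)
    {cb ca : ℚ} (hcb0 : cb ≠ 0)
    (hcb : coordTuple j.1 (T.over u) (fun i => if i = 0 then b else T.toFibre u) t₀ = cb * (p : ℚ) ^ ((j.1 : ℕ) ^ 2))
    (hca : coordTuple j.1 (T.over u) (fun _ => T.toFibre u) t₀ = ca * (p : ℚ) ^ ((j.1 : ℕ) ^ 2)) :
    e 0 b.1 * ca = e 0 u * cb := by
  obtain ⟨s, hss, hfj⟩ := exists_smul_of_mem_PsiOf p hf j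
  have hP : (p : ℚ) ^ ((j.1 : ℕ) ^ 2) ≠ 0 := pow_ne_zero _ (Nat.cast_ne_zero.mpr hp.out.ne_zero)
  set wb : T.Caps j.1 → T.Fibre (T.over u) := fun i => if i = 0 then b else T.toFibre u with hwb
  have h1 := hτe wb (f j)
  have h2 := hτe (fun _ => T.toFibre u) (f j)
  rw [ht wb, hcb, hfj, map_smul, smul_eq_mul, coordTuple_thetaVec1] at h1
  rw [ht _, hca, hfj, map_smul, smul_eq_mul, coordTuple_thetaVec1, if_pos rfl] at h2
  have hτ0 : τ (T.selfIndex j.1) ≠ 0 := by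
    intro h0
    rw [if_neg (by rw [h0]; simpa [wb] using hb), mul_zero, mul_zero] at h1
    exact (mul_ne_zero hcb0 hP) h1
  rw [if_pos (by simp [wb, hτ0])] at h1
  have hsplit : ∀ w : T.Caps j.1 → T.Fibre (T.over u),
      (∏ i, e i (w i).1) = e 0 (w 0).1 * ∏ i ∈ Finset.univ.erase 0, e i (w i).1 := fun w =>
    (Finset.mul_prod_erase Finset.univ (fun i => e i (w i).1) (Finset.mem_univ 0)).symm
  have hrest : (∏ i ∈ Finset.univ.erase (0 : T.Caps j.1), e i (wb i).1) =
      ∏ i ∈ Finset.univ.erase (0 : T.Caps j.1), e i u :=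
    Finset.prod_congr rfl fun i hi => by
      have hi0 : i ≠ 0 := Finset.ne_of_mem_erase hi
      simp [wb, hi0, ThetaIndex.toFibre]
  rw [hsplit, hrest] at h1
  rw [hsplit] at h2
  have hb0 : (wb 0).1 = b.1 := by simp [wb]
  rw [hb0] at h1
  have hu0 : ((fun _ : T.Caps j.1 => T.toFibre u) 0).1 = u := rfl
  rw [hu0] at h2
  set R := ∏ i ∈ Finset.univ.erase (0 : T.Caps j.1), e i u
  have h1' : cb = e 0 b.1 * R * s := mul_right_cancel₀ hP (by rw [h1]; ring)
  have h2' : ca = e 0 u * R * s := mul_right_cancel₀ hP (by rw [h2]; ring)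
  rw [h1', h2']
  ring

end Theta

end Summit.ABC.IUTFork.Charitable

end
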